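import Literature.Computability.Complexity.GateEliminationCase54Q24

/-!
# Gate elimination: Case 5.4.1.4.2.1 of Li–Yang's Theorem 4.1

"Assume that `u = t`. Then `u` is a `2`-variable feeding `E` and `F`, hence unprotected. In this
case, we can first perform the constant substitution to `x` to trivialize `G`, then remove `B` and
`D` by Rule 3. After this, the gates `E` and `F` are exactly fed by two `2`-variables `z` and `u`,
hence we can perform a constant substitution to `z` or `u`, or an affine substitution `u ← z ⊕ c`
for appropriate `c`, such that the outputs of both `E` and `F` become independent of the inputs.
This allows us to make `3` variables (`x`, `z` and `u`) non-influential with `2` substitutions."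
(ECCC TR21-023, §4.1, Case 5.4.1.4.2.1; the paper's `z`, `u` are our `u`, `t`.) PROVED here as
`stepGoal_quad21` (hypothesis `hQ21` of `stepGoal_quadratic_aux`); `B` need not be removed.

## References

* J. Li, T. Yang, *3.1n − o(n) circuit lower bounds for explicit functions*, STOC 2022;
  ECCC TR21-023, §2.4, §4.1 (Case 5.4.1.4.2.1), Lemma 3.11.
-/

namespace Literature.Computability.Complexity

open Finset

namespace Semicircuit

variable {n : ℕ} {f : (Fin n → ZMod 2) → Bool} {d : ℕ} {αφ αI αQ : ℝ}

/-- **Two trivialized gates on one live variable**: `kE`, `kF` are fed by killing constants (at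
`aE`, `aF`) and their other wires are the unprotected variable `v`, read by nobody else; eliminate
both: `v` leaves the influential set, `μ' ≤ μ - α_I`. [cite: LiYang2022, §4.1 (Case 5.4.1.4.2.1), Lemma 3.11] -/
theorem tail_two_triv {C : Semicircuit n} {R : RdqSource n} (hf : IsAffineDisperser f d) (hd : 2 * d ≤ R.dim)
    (hF : C.Fair) (hC : C.ComputesRestr f R) {P : Finset (Fin C.m × Fin C.m)} (hP : C.IsPacking P)
    (hφ : 0 ≤ αφ) (hφ1 : αφ ≤ 1) (hI : 0 ≤ αI) (αQ : ℝ)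
    {kE kF : Fin C.m} {aE aF : Fin 2} {bE bF : Bool} {v : Fin n} (hEF : kE ≠ kF)
    (h₀E : C.arg kE aE = .const bE) (htrivE : C.liveFn kE aE bE false = C.liveFn kE aE bE true)
    (h₀F : C.arg kF aF = .const bF) (htrivF : C.liveFn kF aF bF false = C.liveFn kF aF bF true) (hFv : C.arg kF aF.rev = .var v)
    (hreadv : ∀ k a, C.arg k a = .var v → k = kE ∨ k = kF) (hvp : ¬ R.Protected v) :
    ∃ (C' : Semicircuit n) (P' : Finset (Fin C'.m × Fin C'.m)), C'.Fair ∧ C'.ComputesRestr f R ∧ C'.IsPacking P' ∧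
      C'.measure αφ αI αQ P' R ≤ C.measure αφ αI αQ P R - αI := by
  classical
  have hFnE : ∀ a, C.arg kF a ≠ .gate kE := by
    intro a h
    rcases fin2_eq_or_eq_rev aF a with e' | e'
    · rw [e', h₀F] at h; cases h
    · rw [e', hFv] at h; cases h
  have houtE : C.out ≠ .gate kE := out_ne_of_trivialized hf hd hF hC h₀E htrivE
  let E₁ := elimDataWTriv hF hC hP h₀E htrivE houtE hφ hI αQ
  have hr₁ : ∃ r, E₁.repl = .const r := ⟨_, rfl⟩
  obtain ⟨kF₁, hkF₁⟩ := E₁.ι_surj kF hEF.symm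
  have h₀F₁ : E₁.C'.arg kF₁ aF = .const bF := (E₁.arg_eq_const_iff kF₁ aF bF).mpr (Or.inl (by rw [hkF₁]; exact h₀F))
  have hFv₁ : E₁.C'.arg kF₁ aF.rev = .var v := by rw [E₁.arg_eq_var_iff, hkF₁]; exact Or.inl hFv
  have hopF₁ : E₁.C'.op kF₁ = C.op kF := by rw [elimDataWTriv_op, hkF₁]
  have htrivF₁ : E₁.C'.liveFn kF₁ aF bF false = E₁.C'.liveFn kF₁ aF bF true := by
    unfold liveFn at htrivF ⊢; rw [hopF₁]; exact htrivF
  have houtF : E₁.C'.out ≠ .gate kF₁ := out_ne_of_trivialized hf hd E₁.fair E₁.computes h₀F₁ htrivF₁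
  let E₂ := elimDataWTriv E₁.fair E₁.computes E₁.packing h₀F₁ htrivF₁ houtF hφ hI αQ
  have hr₂ : ∃ r, E₂.repl = .const r := ⟨_, rfl⟩
  -- `v` has no reader afterwards
  have hfv₂ : E₂.C'.fanout (.var v) = 0 := by
    obtain ⟨r₁, hr₁'⟩ := hr₁; obtain ⟨r₂, hr₂'⟩ := hr₂
    have h0 : ∀ k a, E₂.C'.arg k a ≠ .var v := by
      intro k a h
      rw [E₂.arg_eq_var_iff] at h
      rcases h with h | ⟨-, h⟩
      swap; · rw [hr₂'] at h; cases h
      rw [E₁.arg_eq_var_iff] at h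
      rcases h with h | ⟨-, h⟩
      swap; · rw [hr₁'] at h; cases h
      rcases hreadv _ a h with h' | h'
      · exact E₁.ι_ne _ h'
      · exact E₂.ι_ne k (E₁.ι_injective (h'.trans hkF₁.symm))
    unfold fanout; rw [Finset.sum_eq_zero]; intro k _
    rw [card_eq_zero, filter_eq_empty_iff]; exact fun a _ h => h0 k a h
  have hvinf₁ : v ∈ E₁.C'.influential R := E₁.C'.mem_influential_of_reads R hFv₁
  have hinf₂ : ((E₂.C'.influential R).card : ℝ) + 1 ≤ (E₁.C'.influential R).card := by
    have hsub : E₂.C'.influential R ⊆ (E₁.C'.influential R).erase v := by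
      intro i hi
      rw [mem_erase]
      refine ⟨fun hiv => ?_, E₂.influential_subset R hi⟩
      rw [hiv] at hi
      unfold influential at hi; rw [mem_filter, hfv₂] at hi
      rcases hi.2 with h | h
      · omega
      · exact hvp h
    have h1 := card_le_card hsub
    have h2 := card_erase_add_one hvinf₁
    have : (E₂.C'.influential R).card + 1 ≤ (E₁.C'.influential R).card := by omega
    exact_mod_cast this
  have hμ₁ := E₁.measure_le
  have hm₂ : (E₂.C'.m : ℝ) + 1 = E₁.C'.m := by exact_mod_cast E₂.m_add_one
  have hpot₂ := E₂.potential_le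
  have hμ₂ : E₂.C'.measure αφ αI αQ E₂.P' R ≤ E₁.C'.measure αφ αI αQ E₁.P' R - αI := by
    unfold measure
    nlinarith [mul_le_mul_of_nonneg_left hinf₂ hI, mul_le_mul_of_nonneg_left hpot₂ hφ, hφ1, hm₂]
  exact ⟨E₂.C', E₂.P', E₂.fair, E₂.computes, E₂.packing, by linarith⟩

/-- **Two constant gates reading one variable twice**: `kE`, `kF` read the unprotected variable `v`
at both positions and their functions are constant on the diagonal; nobody else reads `v`;
eliminate both: `v` leaves the influential set, `μ' ≤ μ - α_I`. [cite: LiYang2022, §4.1 (Case 5.4.1.4.2.1), Lemma 3.11] -/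
theorem tail_two_coincide {C : Semicircuit n} {R : RdqSource n} (hf : IsAffineDisperser f d) (hd : 2 * d ≤ R.dim)
    (hF : C.Fair) (hC : C.ComputesRestr f R) {P : Finset (Fin C.m × Fin C.m)} (hP : C.IsPacking P)
    (hφ : 0 ≤ αφ) (hφ1 : αφ ≤ 1) (hI : 0 ≤ αI) (αQ : ℝ)
    {kE kF : Fin C.m} {cE cF : Bool} {v : Fin n} (hEF : kE ≠ kF)
    (hwE : ∀ a, C.arg kE a = .var v) (hOE : ∀ s, C.op kE s s = cE)
    (hwF : ∀ a, C.arg kF a = .var v) (hOF : ∀ s, C.op kF s s = cF)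
    (hreadv : ∀ k a, C.arg k a = .var v → k = kE ∨ k = kF) (hvp : ¬ R.Protected v) :
    ∃ (C' : Semicircuit n) (P' : Finset (Fin C'.m × Fin C'.m)), C'.Fair ∧ C'.ComputesRestr f R ∧ C'.IsPacking P' ∧
      C'.measure αφ αI αQ P' R ≤ C.measure αφ αI αQ P R - αI := by
  classical
  have hidE : ∀ (xx : Fin n → Bool) (w : Fin C.m → Bool),
      C.op kE (C.nodeVal xx w (C.arg kE 0)) (C.nodeVal xx w (C.arg kE 1)) = cE := by
    intro xx w; rw [hwE 0, hwE 1]; exact hOE (xx v)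
  have hselfE : ∀ a, C.arg kE a ≠ .gate kE := by intro a h; rw [hwE a] at h; cases h
  have houtE : C.out ≠ .gate kE := out_ne_of_semConst hf hd hF hC (fun xx w hw => by rw [hw kE]; exact hidE xx w)
  let E₁ := elimDataWRedirectConst hF hC hP cE hidE (Or.inl (by rw [hwE 0, hwE 1])) hselfE houtE hφ hI αQ
  have hr₁ : E₁.repl = .const cE := rfl
  obtain ⟨kF₁, hkF₁⟩ := E₁.ι_surj kF hEF.symm
  have hwF₁ : ∀ a, E₁.C'.arg kF₁ a = .var v := by intro a; rw [E₁.arg_eq_var_iff, hkF₁]; exact Or.inl (hwF a)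
  have hopF₁ : E₁.C'.op kF₁ = C.op kF := by rw [elimDataWRedirectConst_op, hkF₁]
  have hidF : ∀ (xx : Fin n → Bool) (w : Fin E₁.C'.m → Bool),
      E₁.C'.op kF₁ (E₁.C'.nodeVal xx w (E₁.C'.arg kF₁ 0)) (E₁.C'.nodeVal xx w (E₁.C'.arg kF₁ 1)) = cF := by
    intro xx w; rw [hwF₁ 0, hwF₁ 1, hopF₁]; exact hOF (xx v)
  have hselfF : ∀ a, E₁.C'.arg kF₁ a ≠ .gate kF₁ := by intro a h; rw [hwF₁ a] at h; cases h
  have houtF : E₁.C'.out ≠ .gate kF₁ :=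
    out_ne_of_semConst hf hd E₁.fair E₁.computes (fun xx w hw => by rw [hw kF₁]; exact hidF xx w)
  let E₂ := elimDataWRedirectConst E₁.fair E₁.computes E₁.packing cF hidF (Or.inl (by rw [hwF₁ 0, hwF₁ 1])) hselfF houtF hφ hI αQ
  have hr₂ : E₂.repl = .const cF := rfl
  have hfv₂ : E₂.C'.fanout (.var v) = 0 := by
    have h0 : ∀ k a, E₂.C'.arg k a ≠ .var v := by
      intro k a h
      rw [E₂.arg_eq_var_iff] at h
      rcases h with h | ⟨-, h⟩
      swap; · rw [hr₂] at h; cases h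
      rw [E₁.arg_eq_var_iff] at h
      rcases h with h | ⟨-, h⟩
      swap; · rw [hr₁] at h; cases h
      rcases hreadv _ a h with h' | h'
      · exact E₁.ι_ne _ h'
      · exact E₂.ι_ne k (E₁.ι_injective (h'.trans hkF₁.symm))
    unfold fanout; rw [Finset.sum_eq_zero]; intro k _
    rw [card_eq_zero, filter_eq_empty_iff]; exact fun a _ h => h0 k a h
  have hvinf₁ : v ∈ E₁.C'.influential R := E₁.C'.mem_influential_of_reads R (hwF₁ 0)
  have hinf₂ : ((E₂.C'.influential R).card : ℝ) + 1 ≤ (E₁.C'.influential R).card := by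
    have hsub : E₂.C'.influential R ⊆ (E₁.C'.influential R).erase v := by
      intro i hi
      rw [mem_erase]
      refine ⟨fun hiv => ?_, E₂.influential_subset R hi⟩
      rw [hiv] at hi
      unfold influential at hi; rw [mem_filter, hfv₂] at hi
      rcases hi.2 with h | h
      · omega
      · exact hvp h
    have h1 := card_le_card hsub
    have h2 := card_erase_add_one hvinf₁
    have : (E₂.C'.influential R).card + 1 ≤ (E₁.C'.influential R).card := by omega
    exact_mod_cast this
  have hμ₁ := E₁.measure_le
  have hm₂ : (E₂.C'.m : ℝ) + 1 = E₁.C'.m := by exact_mod_cast E₂.m_add_one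
  have hpot₂ := E₂.potential_le
  have hμ₂ : E₂.C'.measure αφ αI αQ E₂.P' R ≤ E₁.C'.measure αφ αI αQ E₁.P' R - αI := by
    unfold measure
    nlinarith [mul_le_mul_of_nonneg_left hinf₂ hI, mul_le_mul_of_nonneg_left hpot₂ hφ, hφ1, hm₂]
  exact ⟨E₂.C', E₂.P', E₂.fair, E₂.computes, E₂.packing, by linarith⟩

variable {C : Semicircuit n} {R : RdqSource n} {G : Fin C.m} {x y : Fin n} {B C' D : Fin C.m} {aX aB aC aD : Fin 2}

/-- Killing a conjunction: `((a ⊕ e₁) ∧ (b ⊕ e₂)) ⊕ e₃ = e₃` when `a = e₁` or `b = e₂`. [folklore] -/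
theorem andForm_kill_left (e₁ e₂ e₃ b : Bool) : (((e₁ ^^ e₁) && (b ^^ e₂)) ^^ e₃) = e₃ := by
  cases e₁ <;> cases e₂ <;> cases e₃ <;> cases b <;> rfl

/-- Killing a conjunction on the right factor. [folklore] -/
theorem andForm_kill_right (e₁ e₂ e₃ a : Bool) : (((a ^^ e₁) && (e₂ ^^ e₂)) ^^ e₃) = e₃ := by
  cases e₁ <;> cases e₂ <;> cases e₃ <;> cases a <;> rfl

/-- The affine kill: with `c = e₁ ⊕ e₂ ⊕ 1` the two factors are complementary. [folklore] -/
theorem andForm_kill_affine (e₁ e₂ e₃ s : Bool) : (((s ^^ e₁) && ((s ^^ ((e₂ ^^ e₁) ^^ true)) ^^ e₂)) ^^ e₃) = e₃ := by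
  cases e₁ <;> cases e₂ <;> cases e₃ <;> cases s <;> rfl

/-- The affine kill, other position. [folklore] -/
theorem andForm_kill_affine' (e₁ e₂ e₃ s : Bool) : ((((s ^^ ((e₁ ^^ e₂) ^^ true)) ^^ e₁) && (s ^^ e₂)) ^^ e₃) = e₃ := by
  cases e₁ <;> cases e₂ <;> cases e₃ <;> cases s <;> rfl

/-- **Case 5.4.1.4.2.1 of the proof of Thm. 4.1** (the other reader `F` of `D` reads `t`, the
`2`-variable read by `E`): after `x := b` (eliminating `G`) and the bypass of `D` (passing `u`),
`E` and `F` read exactly `u` and `t`; a second substitution (`t := c`, `u := c`, or `t ← u ⊕ c`)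
makes both constant gates, eliminated: `x`, `t`, `u` leave the influential set, `Δμ ≥ 3α_I ≥ 2δ`.
[cite: LiYang2022, §4.1 (Case 5.4.1.4.2.1)] -/
theorem stepGoal_quad21 (hf : IsAffineDisperser f d) (hd : 2 * d + 2 < R.dim) (hF : C.Fair)
    (hC : C.ComputesRestr f R) (hS : C.Standing R) (hcfg : C.Case5Config G x y B C' D aX aB aC aD)
    (hφ0 : 0 < αφ) (hφ : αφ < 1 / 2) (hI0 : 0 < αI) (hnDB : ¬ C.Reads D B)
    {E : Fin C.m} {aE : Fin 2} {u : Fin n} (hDn : ¬ IsAndOp (C.op D)) (hIu : C.arg D aD.rev = .var u)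
    (hup : ¬ R.Protected u) (hu1 : C.fanout (.var u) = 1) (hD2 : C.fanout (.gate D) = 2)
    (hEand : IsAndOp (C.op E)) (hED : C.arg E aE = .gate D)
    {t : Fin n} {F : Fin C.m} {aF : Fin 2} (hEt : C.arg E aE.rev = .var t) (hft : C.fanout (.var t) = 2) (hFE : F ≠ E)
    (hFD : C.arg F aF = .gate D) (hFt : C.arg F aF.rev = .var t) :
    C.StepGoal f R αφ αI αQ := by
  classical
  have hφ' := hφ0.le
  have hI' := hI0.le
  have hN := hS.normalized.1
  have hGK := hcfg.G_not_mem
  have hDK : D ∉ C.xorPart := fun hDK => hGK (C.mem_of_arg_eq D hDK aD G hcfg.arg_D)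
  have hEK : E ∉ C.xorPart := C.not_mem_xorPart_of_isAndOp hEand
  have hFK : F ∉ C.xorPart := fun h => hDK (C.mem_of_arg_eq F h aF D hFD)
  obtain ⟨cD, hcD⟩ : IsXorOp (C.op D) := C.isXorOp_of_isAffineOp hS.nonDegenerate ((isAndOp_or_isAffineOp _).resolve_left hDn)
  have hED' : E ≠ D := fun h => by rw [h] at hED; exact C.arg_ne_self_of_not_mem hDK _ hED
  have hFD' : F ≠ D := fun h => by rw [h] at hFD; exact C.arg_ne_self_of_not_mem hDK _ hFD
  have hEG : E ≠ G := by
    intro h; rw [h] at hED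
    rcases fin2_eq_or_eq_rev aX aE with e' | e'
    · rw [e', hcfg.arg_G_x] at hED; cases hED
    · rw [e', hcfg.arg_G_y] at hED; cases hED
  have hFG : F ≠ G := by
    intro h; rw [h] at hFD
    rcases fin2_eq_or_eq_rev aX aF with e' | e'
    · rw [e', hcfg.arg_G_x] at hFD; cases hFD
    · rw [e', hcfg.arg_G_y] at hFD; cases hFD
  have hEB : E ≠ B := fun h => hnDB ⟨aE, by rw [← h]; exact hED⟩
  have htu : t ≠ u := by intro h; rw [h] at hEt; have := two_le_fanout hIu hEt hED'.symm; omega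
  have htx : t ≠ x := by
    intro h; rw [h] at hEt
    rcases case5_reader_x hcfg hEt with h' | h'
    · exact hEG h'
    · exact hEB h'
  have hux : u ≠ x := fun h => case5_D_not_x hS hcfg aD.rev (by rw [hIu, h])
  have ht : R.Free t := free_of_reads hC hEt
  have htp : ¬ R.Protected t := fun h => hS.protected_not_and t h E aE.rev hEt hEand
  have hu : R.Free u := free_of_reads hC hIu
  have hDout : C.out ≠ .gate D := out_ne_of_read_bYacyclic hS hEK ⟨aE, hED⟩
  have hreadt : ∀ k a, C.arg k a = .var t → k = E ∨ k = F := by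
    intro k a h
    by_contra hno; rw [not_or] at hno
    have := three_le_fanout hEt hFt h hFE.symm (fun h' => hno.1 h'.symm) (fun h' => hno.2 h'.symm); omega
  have hreadu : ∀ k a, C.arg k a = .var u → k = D := by
    intro k a h; by_contra hk; have := two_le_fanout hIu h (fun h' => hk h'.symm); omega
  have hreadD : ∀ k a, C.arg k a = .gate D → k = E ∨ k = F := by
    intro k a h
    by_contra hno; rw [not_or] at hno
    have := three_le_fanout hED hFD h hFE.symm (fun h' => hno.1 h'.symm) (fun h' => hno.2 h'.symm); omega
  -- step 1: `x := b`, eliminate `G`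
  have hrepl₁ := case5E₁_repl hf hd hF hC hS hcfg hφ' hI' αQ
  have hkD := case5kD_spec hf hd hF hC hS hcfg hφ' hI' αQ
  have hkDc := case5_arg_kD hf hd hF hC hS hcfg hφ' hI' αQ
  have hkDrev := case5_arg_kD_rev hf hd hF hC hS hcfg hφ' hI' αQ
  have hkDu : (case5E₁ hf hd hF hC hS hcfg hφ' hI' αQ).C'.arg (case5kD hf hd hF hC hS hcfg hφ' hI' αQ) aD.rev = .var u := by
    rw [hkDrev, hIu]; rfl
  have hd₁ : 2 * d + 2 ≤ (case5R₁ hC hS hcfg).dim := (case5R₁_dim hC hS hcfg).mpr hd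
  have hx : R.Free x := case5_free_x hC hcfg
  have hxp : ¬ R.Protected x := case5_unprot_x hS hcfg
  have hC₁var : ∀ {k : Fin C.m} {a : Fin 2} {v : Fin n}, (case5C₁ hcfg).arg k a = .var v ↔ C.arg k a = .var v ∧ v ≠ x := by
    intro k a v
    rw [case5C₁_arg]
    cases hka : C.arg k a with
    | const c => exact ⟨(fun h => by cases h), fun h => by cases h.1⟩
    | var i =>
      by_cases hix : i = x
      · rw [hix, Node.substConst_var_self]
        exact ⟨(fun h => by cases h), fun h => absurd (Node.var.inj h.1).symm h.2⟩
      · rw [Node.substConst_var_of_ne hix]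
        exact ⟨(fun h => ⟨h, by cases h; exact hix⟩), fun h => h.1⟩
    | gate g => exact ⟨(fun h => by cases h), fun h => by cases h.1⟩
  have hC₁gate : ∀ {k : Fin C.m} {a : Fin 2} {g : Fin C.m}, (case5C₁ hcfg).arg k a = .gate g ↔ C.arg k a = .gate g := by
    intro k a g
    rw [case5C₁_arg]
    cases hka : C.arg k a with
    | const c => exact ⟨(fun h => by cases h), fun h => by cases h⟩
    | var i =>
      by_cases hix : i = x
      · rw [hix, Node.substConst_var_self]; exact ⟨(fun h => by cases h), fun h => by cases h⟩
      · rw [Node.substConst_var_of_ne hix]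
    | gate g' => exact Iff.rfl
  -- step 2: bypass the ⊕-type `D`, passing `u`
  have hxorD : IsXorOp ((case5E₁ hf hd hF hC hS hcfg hφ' hI' αQ).C'.op (case5kD hf hd hF hC hS hcfg hφ' hI' αQ)) := (case5E₁ hf hd hF hC hS hcfg hφ' hI' αQ).isXorOp_of (by rw [hkD]; exact ⟨cD, hcD⟩)
  obtain ⟨c₁, hc₁⟩ := hxorD
  set bG := (case5C₁ hcfg).liveFn G aX (case5b hcfg) false with hbG
  have hdegD : ∀ t', (case5E₁ hf hd hF hC hS hcfg hφ' hI' αQ).C'.liveFn (case5kD hf hd hF hC hS hcfg hφ' hI' αQ) aD bG t' = (t' ^^ (bG ^^ c₁)) := by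
    intro t'
    show (if aD = 0 then (case5E₁ hf hd hF hC hS hcfg hφ' hI' αQ).C'.op (case5kD hf hd hF hC hS hcfg hφ' hI' αQ) bG t' else (case5E₁ hf hd hF hC hS hcfg hφ' hI' αQ).C'.op (case5kD hf hd hF hC hS hcfg hφ' hI' αQ) t' bG) = _
    split_ifs <;> rw [hc₁] <;> cases t' <;> cases bG <;> cases c₁ <;> rfl
  obtain ⟨ko, hko⟩ := exists_out_eq_gate' hf hF hC (by omega)
  have hC₁out : (case5C₁ hcfg).out = .gate ko := by show (C.out).substConst x (finTwoEquiv (case5c hcfg)) = _; rw [hko]; rfl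
  have houtD₁ : (case5E₁ hf hd hF hC hS hcfg hφ' hI' αQ).C'.out ≠ .gate (case5kD hf hd hF hC hS hcfg hφ' hI' αQ) := by
    intro h
    have := (case5E₁ hf hd hF hC hS hcfg hφ' hI' αQ).out_eq
    rw [h, if_neg (case5C₁_out_ne hf hd hF hC hS hcfg)] at this
    change Node.gate ((case5E₁ hf hd hF hC hS hcfg hφ' hI' αQ).ι (case5kD hf hd hF hC hS hcfg hφ' hI' αQ)) = (case5C₁ hcfg).out at this
    rw [hkD, hC₁out] at this; cases this; exact hDout hko
  let E₂ := elimDataWBypass (case5E₁ hf hd hF hC hS hcfg hφ' hI' αQ).fair (case5E₁ hf hd hF hC hS hcfg hφ' hI' αQ).computes (case5E₁ hf hd hF hC hS hcfg hφ' hI' αQ).packing (bG ^^ c₁) hkDc hdegD houtD₁ hφ' hI' αQ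
  have hr₂ : E₂.repl = .var u := hkDu
  obtain ⟨kE₁, hkE₁⟩ := (case5E₁ hf hd hF hC hS hcfg hφ' hI' αQ).ι_surj E hEG
  obtain ⟨kF₁, hkF₁⟩ := (case5E₁ hf hd hF hC hS hcfg hφ' hI' αQ).ι_surj F hFG
  have hkE₁D : kE₁ ≠ (case5kD hf hd hF hC hS hcfg hφ' hI' αQ) := by intro h; apply hED'; have := congrArg (case5E₁ hf hd hF hC hS hcfg hφ' hI' αQ).ι h; rw [hkE₁, hkD] at this; exact this
  have hkF₁D : kF₁ ≠ (case5kD hf hd hF hC hS hcfg hφ' hI' αQ) := by intro h; apply hFD'; have := congrArg (case5E₁ hf hd hF hC hS hcfg hφ' hI' αQ).ι h; rw [hkF₁, hkD] at this; exact this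
  obtain ⟨kE₂, hkE₂⟩ := E₂.ι_surj kE₁ hkE₁D
  obtain ⟨kF₂, hkF₂⟩ := E₂.ι_surj kF₁ hkF₁D
  have hkEF₂ : kE₂ ≠ kF₂ := fun h => hFE (by rw [← hkF₁, ← hkE₁, ← hkE₂, ← hkF₂, h])
  have hE₂u : E₂.C'.arg kE₂ aE = .var u := by
    rw [E₂.arg_eq_var_iff, hkE₂]; right
    exact ⟨by rw [(case5E₁ hf hd hF hC hS hcfg hφ' hI' αQ).arg_eq_gate_iff, hkE₁, hkD]; exact Or.inl (hC₁gate.mpr hED), hr₂⟩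
  have hF₂u : E₂.C'.arg kF₂ aF = .var u := by
    rw [E₂.arg_eq_var_iff, hkF₂]; right
    exact ⟨by rw [(case5E₁ hf hd hF hC hS hcfg hφ' hI' αQ).arg_eq_gate_iff, hkF₁, hkD]; exact Or.inl (hC₁gate.mpr hFD), hr₂⟩
  have hE₂t : E₂.C'.arg kE₂ aE.rev = .var t := by
    rw [E₂.arg_eq_var_iff, hkE₂]; left; rw [(case5E₁ hf hd hF hC hS hcfg hφ' hI' αQ).arg_eq_var_iff, hkE₁]; exact Or.inl (hC₁var.mpr ⟨hEt, htx⟩)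
  have hF₂t : E₂.C'.arg kF₂ aF.rev = .var t := by
    rw [E₂.arg_eq_var_iff, hkF₂]; left; rw [(case5E₁ hf hd hF hC hS hcfg hφ' hI' αQ).arg_eq_var_iff, hkF₁]; exact Or.inl (hC₁var.mpr ⟨hFt, htx⟩)
  -- readers of `u` and `t` in `E₂.C'`
  have hreadu₂ : ∀ k a, E₂.C'.arg k a = .var u → k = kE₂ ∨ k = kF₂ := by
    intro k a h
    rw [E₂.arg_eq_var_iff] at h
    rcases h with h | ⟨h, -⟩
    · exfalso
      rw [(case5E₁ hf hd hF hC hS hcfg hφ' hI' αQ).arg_eq_var_iff] at h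
      rcases h with h | ⟨-, h⟩
      swap; · rw [hrepl₁] at h; cases h
      have h' := hreadu _ a (hC₁var.mp h).1
      exact E₂.ι_ne k ((case5E₁ hf hd hF hC hS hcfg hφ' hI' αQ).ι_injective (h'.trans hkD.symm))
    · rw [(case5E₁ hf hd hF hC hS hcfg hφ' hI' αQ).arg_eq_gate_iff, hkD] at h
      rcases h with h | ⟨-, h⟩
      swap; · rw [hrepl₁] at h; cases h
      rcases hreadD _ a (hC₁gate.mp h) with h' | h'
      · left; exact E₂.ι_injective (((case5E₁ hf hd hF hC hS hcfg hφ' hI' αQ).ι_injective (h'.trans hkE₁.symm)).trans hkE₂.symm)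
      · right; exact E₂.ι_injective (((case5E₁ hf hd hF hC hS hcfg hφ' hI' αQ).ι_injective (h'.trans hkF₁.symm)).trans hkF₂.symm)
  have hreadt₂ : ∀ k a, E₂.C'.arg k a = .var t → k = kE₂ ∨ k = kF₂ := by
    intro k a h
    rw [E₂.arg_eq_var_iff] at h
    rcases h with h | ⟨-, h⟩
    swap; · rw [hr₂] at h; cases h; exact absurd rfl htu
    rw [(case5E₁ hf hd hF hC hS hcfg hφ' hI' αQ).arg_eq_var_iff] at h
    rcases h with h | ⟨-, h⟩
    swap; · rw [hrepl₁] at h; cases h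
    rcases hreadt _ a (hC₁var.mp h).1 with h' | h'
    · left; exact E₂.ι_injective (((case5E₁ hf hd hF hC hS hcfg hφ' hI' αQ).ι_injective (h'.trans hkE₁.symm)).trans hkE₂.symm)
    · right; exact E₂.ι_injective (((case5E₁ hf hd hF hC hS hcfg hφ' hI' αQ).ι_injective (h'.trans hkF₁.symm)).trans hkF₂.symm)
  -- the source after step 1, dimension, accounting of steps 1–2
  have ht₁ : (case5R₁ hC hS hcfg).Free t := (RdqSource.free_assignFree_iff hx hxp t).mpr ⟨ht, htx⟩
  have htp₁ : ¬ (case5R₁ hC hS hcfg).Protected t := fun h => htp ((RdqSource.protected_assignFree_iff hx hxp t).mp h)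
  have hu₁ : (case5R₁ hC hS hcfg).Free u := (RdqSource.free_assignFree_iff hx hxp u).mpr ⟨hu, hux⟩
  have hup₁ : ¬ (case5R₁ hC hS hcfg).Protected u := fun h => hup ((RdqSource.protected_assignFree_iff hx hxp u).mp h)
  have hdimR₁ : (case5R₁ hC hS hcfg).dim + 1 = R.dim := RdqSource.dim_assignFree (b := case5c hcfg) hx hxp
  have hxinf : x ∈ C.influential R := C.mem_influential_of_reads R hcfg.arg_G_x
  have hμ₁ := measure_substConst_le hφ' αI αQ C.isPacking_empty R (case5R₁ hC hS hcfg) x (finTwoEquiv (case5c hcfg))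
  have hinf₁ : (1 : ℝ) ≤ ((C.influential R).card : ℝ) - ((case5C₁ hcfg).influential (case5R₁ hC hS hcfg)).card := by
    have h1 : ((case5C₁ hcfg).influential (case5R₁ hC hS hcfg)).card ≤ ((C.influential R).erase x).card :=
      card_le_card (C.influential_substConst_assignFree_subset hx hxp (case5c hcfg) (finTwoEquiv (case5c hcfg)))
    have h3 := card_erase_add_one hxinf
    have : ((case5C₁ hcfg).influential (case5R₁ hC hS hcfg)).card + 1 ≤ (C.influential R).card := by omega
    have : (((case5C₁ hcfg).influential (case5R₁ hC hS hcfg)).card : ℝ) + 1 ≤ (C.influential R).card := by exact_mod_cast this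
    linarith
  have hq₁ : ((R.quadCount : ℝ) - ((case5R₁ hC hS hcfg).quadCount : ℝ)) = 0 := by
    have : (case5R₁ hC hS hcfg).quadCount = R.quadCount := RdqSource.quadCount_assignFree hx hxp; rw [this]; ring
  rw [hq₁] at hμ₁
  have hαI₁ := mul_le_mul_of_nonneg_left hinf₁ hI'
  have hμE₁ := (case5E₁ hf hd hF hC hS hcfg hφ' hI' αQ).measure_le
  have hμE₂ := E₂.measure_le
  have hδ := two_liYangDelta_le_three αφ hI' αQ
  -- explicit forms
  have handE₂ : IsAndOp (E₂.C'.op kE₂) := by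
    rw [E₂.isAndOp_iff, hkE₂, (case5E₁ hf hd hF hC hS hcfg hφ' hI' αQ).isAndOp_iff, hkE₁]; exact hEand
  obtain ⟨e₁, e₂, e₃, hOE⟩ := handE₂
  let ktE : Bool := if aE = 0 then e₂ else e₁
  let kuE : Bool := if aE = 0 then e₁ else e₂
  -- the influential sets
  have htinf₂ : t ∈ E₂.C'.influential (case5R₁ hC hS hcfg) := E₂.C'.mem_influential_of_reads _ hE₂t
  have huinf₂ : u ∈ E₂.C'.influential (case5R₁ hC hS hcfg) := E₂.C'.mem_influential_of_reads _ hE₂u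
  have hktE : ktE = (if aE = 0 then e₂ else e₁) := rfl
  have hkuE : kuE = (if aE = 0 then e₁ else e₂) := rfl
  have hE₂out : ∃ g₂, E₂.C'.out = .gate g₂ := by
    have e1 := (case5E₁ hf hd hF hC hS hcfg hφ' hI' αQ).out_eq; rw [if_neg (case5C₁_out_ne hf hd hF hC hS hcfg), hC₁out] at e1
    have ho₁ : ∃ g₁, (case5E₁ hf hd hF hC hS hcfg hφ' hI' αQ).C'.out = .gate g₁ := by
      cases h1o : (case5E₁ hf hd hF hC hS hcfg hφ' hI' αQ).C'.out with
      | const cc => rw [h1o] at e1; change Node.const cc = Node.gate ko at e1; cases e1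
      | var i => rw [h1o] at e1; change Node.var i = Node.gate ko at e1; cases e1
      | gate g₁ => exact ⟨g₁, rfl⟩
    obtain ⟨g₁, hg₁⟩ := ho₁
    have e2 := E₂.out_eq; rw [if_neg houtD₁, hg₁] at e2
    cases h2o : E₂.C'.out with
    | const cc => rw [h2o] at e2; change Node.const cc = Node.gate g₁ at e2; cases e2
    | var i => rw [h2o] at e2; change Node.var i = Node.gate g₁ at e2; cases e2
    | gate g₂ => exact ⟨g₂, rfl⟩
  -- Branch III (affine `t ← u ⊕ c`), for any admissible function of `F`
  let cb : Bool := (ktE ^^ kuE) ^^ true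
  have hIII : ∀ cF : Bool, (∀ s, (E₂.C'.substVar t u cb).op kF₂ s s = cF) → C.StepGoal f R αφ αI αQ := by
    intro cF hOF'
    let cb' : ZMod 2 := finTwoEquiv.symm cb
    have hcb' : finTwoEquiv cb' = cb := finTwoEquiv.apply_symm_apply cb
    let Eq : LinEq n := ⟨{u}, cb'⟩
    have hEq : ∀ i ∈ Eq.support, (case5R₁ hC hS hcfg).lin i = none ∧ i ≠ t := by
      intro i hi
      have : i = u := by simpa [Eq] using hi
      subst this
      exact ⟨hu₁.1, htu.symm⟩
    let R₃ := (case5R₁ hC hS hcfg).assignLin t Eq ht₁ htp₁ hEq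
    have hsol : ∀ v, v ∈ R₃.Sol ↔ v ∈ (case5R₁ hC hS hcfg).Sol ∧ v t = v u + cb' := by
      intro v
      rw [RdqSource.mem_sol_assignLin_iff]
      have : Eq.eval v = v u + cb' := by
        show cb' + ∑ i ∈ ({u} : Finset (Fin n)), v i = _
        rw [sum_singleton, add_comm]
      rw [this]
    have hfree : ∀ i, R₃.Free i ↔ (case5R₁ hC hS hcfg).Free i ∧ i ≠ t := RdqSource.free_assignLin_iff ht₁ htp₁ hEq
    have hdim₃ : R₃.dim + 2 = R.dim := by
      have h1 := RdqSource.dim_assignLin ht₁ htp₁ hEq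
      change R₃.dim + 1 = (case5R₁ hC hS hcfg).dim at h1; omega
    have houtt : E₂.C'.out ≠ .var t := by obtain ⟨g₂, hg₂⟩ := hE₂out; rw [hg₂]; exact fun h => by cases h
    let C₃ := E₂.C'.substVar t u (finTwoEquiv cb')
    have hF₃ : C₃.Fair := E₂.fair.substVar t u _
    have hC₃ : C₃.ComputesRestr f R₃ := E₂.computes.substVar htu.symm hsol hfree hu₁ houtt
    have h3 : 3 ≤ C₃.fanout (.var u) := by
      show 3 ≤ (E₂.C'.substVar t u (finTwoEquiv cb')).fanout (.var u)
      rw [E₂.C'.fanout_substVar_var_target t u _ htu.symm]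
      have := two_le_fanout hE₂u hF₂u hkEF₂
      have := one_le_fanout_of_arg_eq hE₂t
      omega
    obtain ⟨P₃, hP₃, hpot₃⟩ := exists_packing_substVar_noNew E₂.C' t u (finTwoEquiv cb') htu.symm E₂.packing h3
    have hop₃ : ∀ k p q, C₃.op k p q = E₂.C'.op k (p ^^ (cb && decide (E₂.C'.arg k 0 = .var t))) (q ^^ (cb && decide (E₂.C'.arg k 1 = .var t))) := by
      intro k p q; show E₂.C'.op k (p ^^ (finTwoEquiv cb' && _)) (q ^^ (finTwoEquiv cb' && _)) = _; rw [hcb']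
    have hwE : ∀ a, C₃.arg kE₂ a = .var u := by
      intro a
      show (E₂.C'.arg kE₂ a).substVar t u = .var u
      rw [Node.substVar_eq_var_target_iff]
      rcases fin2_eq_or_eq_rev aE a with e' | e'
      · rw [e']; exact Or.inr hE₂u
      · rw [e']; exact Or.inl hE₂t
    have hwF : ∀ a, C₃.arg kF₂ a = .var u := by
      intro a
      show (E₂.C'.arg kF₂ a).substVar t u = .var u
      rw [Node.substVar_eq_var_target_iff]
      rcases fin2_eq_or_eq_rev aF a with e' | e'
      · rw [e']; exact Or.inr hF₂u
      · rw [e']; exact Or.inl hF₂t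
    have hOE' : ∀ s, C₃.op kE₂ s s = e₃ := by
      intro s
      rw [hop₃, hOE]
      rcases fin2_eq_or_eq_rev 0 aE with e0 | e0
      · have h0 : E₂.C'.arg kE₂ 0 = .var u := by rw [← e0]; exact hE₂u
        have h1 : E₂.C'.arg kE₂ 1 = .var t := by rw [show (1 : Fin 2) = Fin.rev 0 from rfl, ← e0]; exact hE₂t
        rw [h0, h1, decide_eq_false (fun h => htu (Node.var.inj h).symm), decide_eq_true rfl, Bool.and_false, Bool.xor_false,
          Bool.and_true]
        show (((s ^^ e₁) && ((s ^^ ((ktE ^^ kuE) ^^ true)) ^^ e₂)) ^^ e₃) = e₃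
        rw [hktE, hkuE, if_pos e0, if_pos e0]; exact andForm_kill_affine e₁ e₂ e₃ s
      · have e1 : aE = 1 := by rw [e0]; rfl
        have h1 : E₂.C'.arg kE₂ 1 = .var u := by rw [← e1]; exact hE₂u
        have h0 : E₂.C'.arg kE₂ 0 = .var t := by rw [show (0 : Fin 2) = Fin.rev 1 from rfl, ← e1]; exact hE₂t
        rw [h0, h1, decide_eq_false (fun h => htu (Node.var.inj h).symm), decide_eq_true rfl, Bool.and_false, Bool.xor_false,
          Bool.and_true]
        show ((((s ^^ ((ktE ^^ kuE) ^^ true)) ^^ e₁) && (s ^^ e₂)) ^^ e₃) = e₃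
        rw [hktE, hkuE, if_neg (by rw [e1]; decide), if_neg (by rw [e1]; decide)]; exact andForm_kill_affine' e₁ e₂ e₃ s
    have hOF'' : ∀ s, C₃.op kF₂ s s = cF := by
      intro s; have := hOF' s
      change (E₂.C'.substVar t u cb).op kF₂ s s = cF at this
      show (E₂.C'.substVar t u (finTwoEquiv cb')).op kF₂ s s = cF
      rw [hcb']; exact this
    have hreadu₃ : ∀ k a, C₃.arg k a = .var u → k = kE₂ ∨ k = kF₂ := by
      intro k a h
      change (E₂.C'.arg k a).substVar t u = .var u at h
      rw [Node.substVar_eq_var_target_iff] at h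
      rcases h with h | h
      · exact hreadt₂ k a h
      · exact hreadu₂ k a h
    have hup₃ : ¬ R₃.Protected u := fun h => hup₁ ((RdqSource.protected_assignLin_iff ht₁ htp₁ hEq u).mp h)
    obtain ⟨C', P', hF', hC', hP', hμ'⟩ := tail_two_coincide hf (by omega) hF₃ hC₃ hP₃ hφ' (by linarith) hI' αQ hkEF₂
      hwE hOE' hwF hOF'' hreadu₃ hup₃
    -- accounting of the affine substitution
    have hinf₃ : ((C₃.influential R₃).card : ℝ) + 1 ≤ (E₂.C'.influential (case5R₁ hC hS hcfg)).card := by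
      have hfreej : ¬ R₃.Free t := fun h => ((hfree t).mp h).2 rfl
      have hprot : ∀ i, R₃.Protected i → (case5R₁ hC hS hcfg).Protected i := fun i h => (RdqSource.protected_assignLin_iff ht₁ htp₁ hEq i).mp h
      have h1 := E₂.C'.influential_substVar_subset t u (finTwoEquiv cb') htu.symm hfreej hprot
      have h2 : insert u ((E₂.C'.influential (case5R₁ hC hS hcfg)).erase t) = (E₂.C'.influential (case5R₁ hC hS hcfg)).erase t :=
        insert_eq_of_mem (mem_erase.mpr ⟨htu.symm, huinf₂⟩)
      rw [h2] at h1
      have h3 := card_le_card h1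
      change (C₃.influential R₃).card ≤ _ at h3
      have h4 := card_erase_add_one htinf₂
      have : (C₃.influential R₃).card + 1 ≤ (E₂.C'.influential (case5R₁ hC hS hcfg)).card := by omega
      exact_mod_cast this
    have hq₃ : (R₃.quadCount : ℝ) = (case5R₁ hC hS hcfg).quadCount := rfl
    have hpot₃' : (C₃.potential P₃ : ℝ) ≤ E₂.C'.potential E₂.P' := by exact_mod_cast hpot₃
    have hμ₃ : C₃.measure αφ αI αQ P₃ R₃ ≤ E₂.C'.measure αφ αI αQ E₂.P' (case5R₁ hC hS hcfg) - αI := by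
      unfold measure
      rw [hq₃]
      show ((E₂.C'.m : ℕ) : ℝ) + _ + _ + _ ≤ _
      nlinarith [mul_le_mul_of_nonneg_left hinf₃ hI', mul_le_mul_of_nonneg_left hpot₃' hφ']
    refine Or.inr ⟨2, by norm_num, by norm_num, C', R₃, P', hF', hC', hP', hdim₃, ?_⟩
    push_cast
    linarith
  -- Branches I/II: a constant to `t` or to `u`
  have hconst : ∀ (w z : Fin n) (aKE aKF : Fin 2) (b : Bool), w ≠ z → w ≠ x →
      E₂.C'.arg kE₂ aKE = .var w → E₂.C'.arg kE₂ aKE.rev = .var z →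
      E₂.C'.arg kF₂ aKF = .var w → E₂.C'.arg kF₂ aKF.rev = .var z →
      (∀ s, E₂.C'.liveFn kE₂ aKE b s = E₂.C'.liveFn kE₂ aKE b (!s)) → (∀ s, E₂.C'.liveFn kF₂ aKF b s = E₂.C'.liveFn kF₂ aKF b (!s)) →
      (∀ k a, E₂.C'.arg k a = .var z → k = kE₂ ∨ k = kF₂) →
      (case5R₁ hC hS hcfg).Free w → ¬ (case5R₁ hC hS hcfg).Protected w → ¬ (case5R₁ hC hS hcfg).Protected z →
      w ∈ E₂.C'.influential (case5R₁ hC hS hcfg) → C.StepGoal f R αφ αI αQ := by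
    intro w z aKE aKF b hwz hwx hEw hEz hFw hFz htE htF hreadz hw₁ hwp₁ hzp₁ hwinf
    let b' : ZMod 2 := finTwoEquiv.symm b
    have hb' : finTwoEquiv b' = b := finTwoEquiv.apply_symm_apply b
    let C₃ := E₂.C'.substConst w (finTwoEquiv b')
    let R₃ := (case5R₁ hC hS hcfg).assignFree w b' hw₁ hwp₁
    have hF₃ : C₃.Fair := E₂.fair.substConst w _
    have hC₃ : C₃.ComputesRestr f R₃ := E₂.computes.substConst_assignFree hw₁ hwp₁ b'
    have hP₃ : C₃.IsPacking (E₂.C'.substConstPacking w (finTwoEquiv b') E₂.P') := E₂.packing.substConst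
    have hdim₃ : R₃.dim + 2 = R.dim := by
      have h1 := RdqSource.dim_assignFree (b := b') hw₁ hwp₁
      change R₃.dim + 1 = (case5R₁ hC hS hcfg).dim at h1; omega
    have h₀E : C₃.arg kE₂ aKE = .const b := by
      show (E₂.C'.arg kE₂ aKE).substConst w _ = _; rw [hEw, Node.substConst_var_self]
      show Node.const (finTwoEquiv b') = Node.const b; rw [hb']
    have h₀F : C₃.arg kF₂ aKF = .const b := by
      show (E₂.C'.arg kF₂ aKF).substConst w _ = _; rw [hFw, Node.substConst_var_self]
      show Node.const (finTwoEquiv b') = Node.const b; rw [hb']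
    have hFz₃ : C₃.arg kF₂ aKF.rev = .var z := by
      show (E₂.C'.arg kF₂ aKF.rev).substConst w _ = _; rw [hFz, Node.substConst_var_of_ne hwz.symm]
    have htrivE : C₃.liveFn kE₂ aKE b false = C₃.liveFn kE₂ aKE b true := htE false
    have htrivF : C₃.liveFn kF₂ aKF b false = C₃.liveFn kF₂ aKF b true := htF false
    have hreadz₃ : ∀ k a, C₃.arg k a = .var z → k = kE₂ ∨ k = kF₂ := by
      intro k a h
      change (E₂.C'.arg k a).substConst w _ = .var z at h
      have h' : E₂.C'.arg k a = .var z := by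
        cases hh : E₂.C'.arg k a with
        | const c => rw [hh] at h; cases h
        | var i =>
          rw [hh] at h
          by_cases hiw : i = w
          · rw [hiw, Node.substConst_var_self] at h; cases h
          · rw [Node.substConst_var_of_ne hiw] at h; cases h; rfl
        | gate g => rw [hh] at h; cases h
      exact hreadz k a h'
    have hzp₃ : ¬ R₃.Protected z := fun h => hzp₁ ((RdqSource.protected_assignFree_iff hw₁ hwp₁ z).mp h)
    obtain ⟨C', P', hF', hC', hP', hμ'⟩ := tail_two_triv hf (by omega) hF₃ hC₃ hP₃ hφ' (by linarith) hI' αQ hkEF₂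
      h₀E htrivE h₀F htrivF hFz₃ hreadz₃ hzp₃
    have hμ₃ := measure_substConst_le hφ' αI αQ E₂.packing (case5R₁ hC hS hcfg) R₃ w (finTwoEquiv b')
    have hinf₃ : (1 : ℝ) ≤ ((E₂.C'.influential (case5R₁ hC hS hcfg)).card : ℝ) - (C₃.influential R₃).card := by
      have h1 : (C₃.influential R₃).card ≤ ((E₂.C'.influential (case5R₁ hC hS hcfg)).erase w).card :=
        card_le_card (E₂.C'.influential_substConst_assignFree_subset hw₁ hwp₁ b' (finTwoEquiv b'))
      have h3 := card_erase_add_one hwinf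
      have : (C₃.influential R₃).card + 1 ≤ (E₂.C'.influential (case5R₁ hC hS hcfg)).card := by omega
      have : ((C₃.influential R₃).card : ℝ) + 1 ≤ (E₂.C'.influential (case5R₁ hC hS hcfg)).card := by exact_mod_cast this
      linarith
    have hq₃ : (((case5R₁ hC hS hcfg).quadCount : ℝ) - (R₃.quadCount : ℝ)) = 0 := by
      have : R₃.quadCount = (case5R₁ hC hS hcfg).quadCount := RdqSource.quadCount_assignFree hw₁ hwp₁; rw [this]; ring
    rw [hq₃] at hμ₃
    have hαI₃ := mul_le_mul_of_nonneg_left hinf₃ hI'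
    refine Or.inr ⟨2, by norm_num, by norm_num, C', R₃, P', hF', hC', hP', hdim₃, ?_⟩
    push_cast
    nlinarith [hμ₁, hαI₁, hμE₁, hμE₂, hμ₃, hμ', hαI₃, hδ]
  -- the killing identities for `E`
  have hkillEt : ∀ s, E₂.C'.liveFn kE₂ aE.rev ktE s = E₂.C'.liveFn kE₂ aE.rev ktE (!s) := by
    intro s
    show (if aE.rev = 0 then E₂.C'.op kE₂ ktE s else E₂.C'.op kE₂ s ktE) = (if aE.rev = 0 then E₂.C'.op kE₂ ktE (!s) else E₂.C'.op kE₂ (!s) ktE)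
    rcases fin2_eq_or_eq_rev 0 aE with e0 | e0
    · rw [if_neg (by rw [e0]; decide), if_neg (by rw [e0]; decide), hOE, hOE, hktE, if_pos e0, andForm_kill_right, andForm_kill_right]
    · have e1 : aE = 1 := by rw [e0]; rfl
      rw [if_pos (by rw [e1]; rfl), if_pos (by rw [e1]; rfl), hOE, hOE, hktE, if_neg (by rw [e1]; decide), andForm_kill_left, andForm_kill_left]
  have hkillEu : ∀ s, E₂.C'.liveFn kE₂ aE kuE s = E₂.C'.liveFn kE₂ aE kuE (!s) := by
    intro s
    show (if aE = 0 then E₂.C'.op kE₂ kuE s else E₂.C'.op kE₂ s kuE) = (if aE = 0 then E₂.C'.op kE₂ kuE (!s) else E₂.C'.op kE₂ (!s) kuE)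
    rcases fin2_eq_or_eq_rev 0 aE with e0 | e0
    · rw [if_pos e0, if_pos e0, hOE, hOE, hkuE, if_pos e0, andForm_kill_left, andForm_kill_left]
    · have e1 : aE = 1 := by rw [e0]; rfl
      rw [if_neg (by rw [e1]; decide), if_neg (by rw [e1]; decide), hOE, hOE, hkuE, if_neg (by rw [e1]; decide),
        andForm_kill_right, andForm_kill_right]
  by_cases hFand : IsAndOp (C.op F)
  · have handF₂ : IsAndOp (E₂.C'.op kF₂) := by
      rw [E₂.isAndOp_iff, hkF₂, (case5E₁ hf hd hF hC hS hcfg hφ' hI' αQ).isAndOp_iff, hkF₁]; exact hFand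
    obtain ⟨f₁, f₂, f₃, hOF⟩ := handF₂
    let ktF : Bool := if aF = 0 then f₂ else f₁
    let kuF : Bool := if aF = 0 then f₁ else f₂
    have hktF : ktF = (if aF = 0 then f₂ else f₁) := rfl
    have hkuF : kuF = (if aF = 0 then f₁ else f₂) := rfl
    have hkillFt : ∀ s, E₂.C'.liveFn kF₂ aF.rev ktF s = E₂.C'.liveFn kF₂ aF.rev ktF (!s) := by
      intro s
      show (if aF.rev = 0 then E₂.C'.op kF₂ ktF s else E₂.C'.op kF₂ s ktF) = (if aF.rev = 0 then E₂.C'.op kF₂ ktF (!s) else E₂.C'.op kF₂ (!s) ktF)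
      rcases fin2_eq_or_eq_rev 0 aF with e0 | e0
      · rw [if_neg (by rw [e0]; decide), if_neg (by rw [e0]; decide), hOF, hOF, hktF, if_pos e0, andForm_kill_right, andForm_kill_right]
      · have e1 : aF = 1 := by rw [e0]; rfl
        rw [if_pos (by rw [e1]; rfl), if_pos (by rw [e1]; rfl), hOF, hOF, hktF, if_neg (by rw [e1]; decide), andForm_kill_left, andForm_kill_left]
    have hkillFu : ∀ s, E₂.C'.liveFn kF₂ aF kuF s = E₂.C'.liveFn kF₂ aF kuF (!s) := by
      intro s
      show (if aF = 0 then E₂.C'.op kF₂ kuF s else E₂.C'.op kF₂ s kuF) = (if aF = 0 then E₂.C'.op kF₂ kuF (!s) else E₂.C'.op kF₂ (!s) kuF)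
      rcases fin2_eq_or_eq_rev 0 aF with e0 | e0
      · rw [if_pos e0, if_pos e0, hOF, hOF, hkuF, if_pos e0, andForm_kill_left, andForm_kill_left]
      · have e1 : aF = 1 := by rw [e0]; rfl
        rw [if_neg (by rw [e1]; decide), if_neg (by rw [e1]; decide), hOF, hOF, hkuF, if_neg (by rw [e1]; decide),
          andForm_kill_right, andForm_kill_right]
    by_cases h1 : ktE = ktF
    · -- Branch I: `t := ktE`
      exact hconst t u aE.rev aF.rev ktE htu htx hE₂t (by rw [Fin.rev_rev]; exact hE₂u) hF₂t (by rw [Fin.rev_rev]; exact hF₂u)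
        hkillEt (by rw [h1]; exact hkillFt) hreadu₂ ht₁ htp₁ hup₁ htinf₂
    by_cases h2 : kuE = kuF
    · -- Branch II: `u := kuE`
      exact hconst u t aE aF kuE htu.symm hux hE₂u hE₂t hF₂u hF₂t hkillEu (by rw [h2]; exact hkillFu) hreadt₂ hu₁ hup₁ htp₁ huinf₂
    · -- Branch III with `F` ∧-type: the same `c` kills `F`
      have hcb : cb = ((ktF ^^ kuF) ^^ true) := by
        have key : ∀ a b a' b' : Bool, a ≠ a' → b ≠ b' → ((a ^^ b) ^^ true) = ((a' ^^ b') ^^ true) := by decide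
        exact key ktE kuE ktF kuF h1 h2
      refine hIII f₃ (fun s => ?_)
      show E₂.C'.op kF₂ (s ^^ (cb && decide (E₂.C'.arg kF₂ 0 = .var t))) (s ^^ (cb && decide (E₂.C'.arg kF₂ 1 = .var t))) = f₃
      rw [hOF, hcb]
      rcases fin2_eq_or_eq_rev 0 aF with e0 | e0
      · have h0 : E₂.C'.arg kF₂ 0 = .var u := by rw [← e0]; exact hF₂u
        have h1' : E₂.C'.arg kF₂ 1 = .var t := by rw [show (1 : Fin 2) = Fin.rev 0 from rfl, ← e0]; exact hF₂t
        rw [h0, h1', decide_eq_false (fun h => htu (Node.var.inj h).symm), decide_eq_true rfl, Bool.and_false, Bool.xor_false,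
          Bool.and_true, hktF, hkuF, if_pos e0, if_pos e0]
        exact andForm_kill_affine f₁ f₂ f₃ s
      · have e1 : aF = 1 := by rw [e0]; rfl
        have h1' : E₂.C'.arg kF₂ 1 = .var u := by rw [← e1]; exact hF₂u
        have h0 : E₂.C'.arg kF₂ 0 = .var t := by rw [show (0 : Fin 2) = Fin.rev 1 from rfl, ← e1]; exact hF₂t
        rw [h0, h1', decide_eq_false (fun h => htu (Node.var.inj h).symm), decide_eq_true rfl, Bool.and_false, Bool.xor_false,
          Bool.and_true, hktF, hkuF, if_neg (by rw [e1]; decide), if_neg (by rw [e1]; decide)]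
        exact andForm_kill_affine' f₁ f₂ f₃ s
  · -- Branch III with `F` ⊕-type
    have hFxor : IsXorOp (C.op F) := C.isXorOp_of_isAffineOp hS.nonDegenerate ((isAndOp_or_isAffineOp _).resolve_left hFand)
    have hxorF₂ : IsXorOp (E₂.C'.op kF₂) :=
      E₂.isXorOp_of (by rw [hkF₂]; exact (case5E₁ hf hd hF hC hS hcfg hφ' hI' αQ).isXorOp_of (by rw [hkF₁]; exact hFxor))
    obtain ⟨fx, hOFx⟩ := hxorF₂
    refine hIII (cb ^^ fx) (fun s => ?_)
    show E₂.C'.op kF₂ (s ^^ (cb && decide (E₂.C'.arg kF₂ 0 = .var t))) (s ^^ (cb && decide (E₂.C'.arg kF₂ 1 = .var t))) = (cb ^^ fx)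
    rw [hOFx]
    rcases fin2_eq_or_eq_rev 0 aF with e0 | e0
    · have h0 : E₂.C'.arg kF₂ 0 = .var u := by rw [← e0]; exact hF₂u
      have h1' : E₂.C'.arg kF₂ 1 = .var t := by rw [show (1 : Fin 2) = Fin.rev 0 from rfl, ← e0]; exact hF₂t
      rw [h0, h1', decide_eq_false (fun h => htu (Node.var.inj h).symm), decide_eq_true rfl, Bool.and_false, Bool.xor_false,
        Bool.and_true]
      cases s <;> cases cb <;> cases fx <;> rfl
    · have e1 : aF = 1 := by rw [e0]; rfl
      have h1' : E₂.C'.arg kF₂ 1 = .var u := by rw [← e1]; exact hF₂u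
      have h0 : E₂.C'.arg kF₂ 0 = .var t := by rw [show (0 : Fin 2) = Fin.rev 1 from rfl, ← e1]; exact hF₂t
      rw [h0, h1', decide_eq_false (fun h => htu (Node.var.inj h).symm), decide_eq_true rfl, Bool.and_false, Bool.xor_false,
        Bool.and_true]
      cases s <;> cases cb <;> cases fx <;> rfl

end Semicircuit

end Literature.Computability.Complexity
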